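import Summits.Ventures.AbcSig.Rows.Bridge
import Summits.Ventures.AbcSig.Rows.C2aL331A0
import Summits.Ventures.AbcSig.Rows.C2aL331A0AB

/-!
# Venture AbcSig — CELL `C2aL331A0`: the census statement `Rows.C2aCellRed 331 (fun a => a = 0) ∅` from the two row theorems

HONEST FRAMING. COMPUTATION cell `pub-abcsig`; CONDITIONAL theorem; no claim on ABC or any summit. Hypotheses exactly as in
`Rows/C2aL331A0.lean` and `Rows/C2aL331A0AB.lean`: `BS04Package` (CITED), `DataComplete` / `RefinesCPSymAll` (COMPUTED, certified level files;
norm-form certificates), `EisPackage` (CITED) + `Refines` (COMPUTED) for the kernel M6 discharges, and the rows' per-orbit CITED exclusions universally quantified in the exponent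
(shared by both distributions (a = 0: the second is the first with x, y swapped)). Conclusion = p1's census predicate (`Rows/Statements.lean`) with the residual of the row of
record `census/rows/C2a/C2a-l331-a0.md` (sha16 `bc7dff385ae3de0e`): all four coprime distributions `A·B = 2^0·331^m`, reduced exponents.
GENERATED by p-lean g4 `gen4/c2arow2.py` (pattern of `Rows/C2aL277A0XCell.lean`).
-/

namespace Summit.Ventures.AbcSig

/-- Cell `C2aL331A0`: `Rows.C2aCellRed 331 (fun a => a = 0) ∅` under the rows' hypotheses. -/
theorem xcell_C2aL331A0 (M : NewformModel) (hP : M.BS04Package)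
    (hE : M.EisPackage)
    (hR_orbit_662_2 : M.Refines 662 orbit_662_2 m6X_662_2)
    (hR_orbit_662_5 : M.Refines 662 orbit_662_5 m6X_662_5)
    (hD10592 : M.DataComplete 10592 level10592Orbits) (hCP10592 : M.RefinesCPSymAll 10592 level10592CP)
    (hD662 : M.DataComplete 662 level662Orbits)
    (hX_orbit_10592_3 : ∀ n m : ℕ, n ∈ ([83] : List ℕ) → M.Excludes 10592 orbit_10592_3 (famB (2 ^ 0 * 331 ^ m) n (fun _ _ => True)))
    (hX_orbit_10592_6 : ∀ n m : ℕ, n ∈ ([83] : List ℕ) → M.Excludes 10592 orbit_10592_6 (famB (2 ^ 0 * 331 ^ m) n (fun _ _ => True))) :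
    Rows.C2aCellRed 331 (fun a => a = 0) ∅ :=
  C2aCellRed_of_rows 331 (by norm_num) (by norm_num) _ _
    (fun n hn h11 hnℓ _ a m (ha : a = 0) han hm hmn x y z h1 h2 => by
      subst ha
      exact xrow_C2aL331A0 M hP hE hR_orbit_662_2 hR_orbit_662_5 hD10592 hCP10592 hD662 n hn h11 hnℓ  m hm hmn (hX_orbit_10592_3 n m) (hX_orbit_10592_6 n m) x y z h1 h2)
    (fun n hn h11 hnℓ _ a m (ha : a = 0) han hm hmn x y z h1 h2 => by
      subst ha
      exact xrow_C2aL331A0AB M hP hE hR_orbit_662_2 hR_orbit_662_5 hD10592 hCP10592 hD662 n hn h11 hnℓ  m hm hmn (hX_orbit_10592_3 n m) (hX_orbit_10592_6 n m) x y z h1 h2)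

end Summit.Ventures.AbcSig
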